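import Literature.NumberTheory.EllipticCurves.Shintani32LiftUnfolded
import Literature.NumberTheory.EllipticCurves.Shintani32KohnenWeight
import HarnessLib

/-!
# The theta lift of a weight-`2` cusp form on `Γ₀(32)` against a GENERIC level-`32` kernel `𝒦₃₂[c, t]`

[[cite: Shintani1975, §2 (2.1), (2.8)–(2.9), (2.12), (2.14), Props. 2.1, 2.3, 2.4]] — the lift
machinery of `Shintani32LiftUnfolded` for an ARBITRARY bounded `Γ₀(32)`-invariant weight `c` on
the coordinates of `L♮₃₂ = {[32a, b, c]}` and an arbitrary scale `t > 0`
(`Shintani32Kernel.genKernel32 c t`).  Besides `kerD32` (`c = c_D`, `t = 1/(128D)`) and the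
Kohnen-type kernel `kerK` (`c = χ_{D*}`, `t = 1/D`, `Shintani32KohnenKernelLaw`) this covers the
transformed kernels `𝒦_D(w, gz)`, `g ∈ SL₂(ℤ)`, which are again of this form
(`Shintani32KohnenKernelLaw.kerK_smul`: weight the Gauss coefficient sums, scale `1/(16384D)`) —
the input of the cusp analysis of the lifts at ALL cusps.  Four parts, everything PROVED:

1. **The lift** (`liftG c t φ z = ∫_{Γ₀(32)∖ℍ} φ(w) 𝒦₃₂[c,t](w, z) dμ(w)`): the kernel bound at
   translates (`exists_norm_genKernel32_smul_le`), measurability, `liftIntegrandG_smul`,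
   `integrableOn_liftIntegrandG`, `isThetaAutomorphic_liftG` (automorphy of the lift from that of
   the kernel).
2. **Unfolding**: `liftG_eq_tsum_integral` (termwise integration), `liftTermG_smul`,
   `tsum_quotient_integral_liftTermG_eq` (the orbit identity), `liftTermG_stab_invariant` — the
   group `Γ₀(32)⁺`, its action on `ℤ³` and the fundamental domains are those of `Shintani32LiftUnfolded`.
3. **Null and definite orbits vanish** (strip reduction via the unipotent stabiliser, Cayley
   reduction), whence `liftG_eq_tsum_orbitIntegralG`:
   `Φ[c,t](z) = √(Im z) ∑_{[k]: disc > 0} ∫_{F_k} φ(w) c(k) f_{w,tz}(ι♮₃₂ k) dμ(w)`.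
4. **Exponential decay at `i∞`**, uniformly in `Re z` and WITHOUT evaluating the orbits
   (`norm_liftG_le`): only indefinite orbits contribute, on them `disc ι♮₃₂(k) = Δ(k) ≥ 1`, and
   `q_w⁺(x) ≥ disc x` gives `‖f_{w,tz}(x)‖ ≤ e^{-2πt(Im z - Im z₀)} ‖f_{w,tz₀}(x)‖`; regrouping the
   absolute orbit sums (`OrbitStabilizerSums`) bounds everything by
   `e^{-2πt(Im z - Im z₀)} ∑_k ∫_F ‖term_k(z₀)‖ < ∞`.

No named facts; definitions `liftIntegrandG`, `liftG`, `liftTermG`, `orbitIntegralG`.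
-/

noncomputable section

open Complex Real MeasureTheory Filter Asymptotics
open scoped MatrixGroups ModularForm Modular Topology Pointwise

namespace Literature.NumberTheory.EllipticCurves.Shintani

open UpperHalfPlane hiding I
open CongruenceSubgroup ModularGroup
open Literature.NumberTheory.EllipticCurves.ModularForms

section KernelBound

variable {c : (Fin 3 → ℤ) → ℂ} (hb : BddWeight c) (t : ℝ) (ht : 0 < t)
include hb

/-- **The generic kernel at a translate**: for `Im τ ≥ 1/2`,
`‖𝒦₃₂[c,t](aτ; z)‖ ≤ √(Im z) ‖cτ+d‖⁻² C_z (Im τ)²`, uniformly in `a ∈ SL₂(ℤ)`. [cite: Shintani1975, §2] -/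
theorem exists_norm_genKernel32_smul_le (z : ℍ) :
    ∃ Cz : ℝ, 0 ≤ Cz ∧ ∀ (a : SL(2, ℤ)) (τ : ℍ), 1 / 2 ≤ τ.im →
      ‖genKernel32 c t ht (a • τ) z‖ ≤ Real.sqrt z.im * (‖denom (a : GL (Fin 2) ℝ) τ‖ ^ 2)⁻¹ * (Cz * τ.im ^ 2) := by
  obtain ⟨C, hC⟩ := hb
  have hC0 : 0 ≤ C := le_trans (norm_nonneg _) (hC 0)
  set Z : ℍ := mulPos t ht z with hZ
  have ha : 0 < 2 * π * Z.im := by have := Z.im_pos; positivity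
  set C0 : ℝ := thetaZ (2 * ((2 * π * Z.im) / 2) * (1 / 2) ^ 2) * thetaZ ((2 * π * Z.im) / 2) *
      thetaZ (2 * ((2 * π * Z.im) / 2) / (1 / 2) ^ 2) / ((1 / 2) * Real.sqrt (2 * (2 * π * Z.im))) with hC0def
  have hC00 : 0 ≤ C0 := by
    rw [hC0def]
    refine div_nonneg (mul_nonneg (mul_nonneg (thetaZ_nonneg _) (thetaZ_nonneg _)) (thetaZ_nonneg _)) ?_
    positivity
  refine ⟨C * C0, mul_nonneg hC0 hC00, fun a τ hτ ↦ ?_⟩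
  obtain ⟨hS, hB⟩ := tsum_norm_formEval_mul_exp_le ha (half_pos one_pos) τ hτ
  unfold genKernel32
  rw [norm_mul, Complex.norm_real, Real.norm_of_nonneg (Real.sqrt_nonneg _), mul_assoc]
  refine mul_le_mul_of_nonneg_left ?_ (Real.sqrt_nonneg _)
  have hs1 : Summable fun k : Fin 3 → ℤ ↦ ‖shintaniFn (a • τ) Z (latSharp32 k)‖ := by
    have := summable_term32 (c := fun _ ↦ (1 : ℂ)) ⟨1, fun _ ↦ by simp⟩ (a • τ) Z
    simpa using this.norm
  have hsum := summable_term32 ⟨C, hC⟩ (a • τ) Z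
  calc ‖∑' k : Fin 3 → ℤ, c k * shintaniFn (a • τ) Z (latSharp32 k)‖
      ≤ ∑' k : Fin 3 → ℤ, ‖c k * shintaniFn (a • τ) Z (latSharp32 k)‖ := norm_tsum_le_tsum_norm hsum.norm
    _ ≤ ∑' k : Fin 3 → ℤ, C * ‖shintaniFn (a • τ) Z (latSharp32 k)‖ := by
        refine Summable.tsum_le_tsum (fun k ↦ ?_) hsum.norm (hs1.mul_left C)
        rw [norm_mul]
        exact mul_le_mul_of_nonneg_right (hC k) (norm_nonneg _)
    _ = C * ∑' k : Fin 3 → ℤ, ‖shintaniFn (a • τ) Z (latSharp32 k)‖ := tsum_mul_left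
    _ ≤ C * ((‖denom (a : GL (Fin 2) ℝ) τ‖ ^ 2)⁻¹ * (C0 * τ.im ^ 2)) := by
        refine mul_le_mul_of_nonneg_left ?_ hC0
        exact (tsum_norm_shintaniFn_smul_le32 a τ Z).trans (mul_le_mul_of_nonneg_left hB (by positivity))
    _ = _ := by ring

end KernelBound

section Measurability

variable {c : (Fin 3 → ℤ) → ℂ} (hb : BddWeight c) (t : ℝ) (ht : 0 < t)
include hb

/-- `w ↦ 𝒦₃₂[c,t](w, z)` is measurable (limit of the continuous partial sums). [folklore] -/
theorem measurable_genKernel32 (z : ℍ) : Measurable fun w : ℍ ↦ genKernel32 c t ht w z := by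
  set Z : ℍ := mulPos t ht z with hZ
  have hcont : ∀ k : Fin 3 → ℤ, Continuous fun w : ℍ ↦ c k * shintaniFn w Z (latSharp32 k) :=
    fun k ↦ continuous_const.mul (continuous_shintaniFn_left Z _)
  have hlim : Tendsto (fun s : Finset (Fin 3 → ℤ) ↦ fun w : ℍ ↦
      ∑ k ∈ s, c k * shintaniFn w Z (latSharp32 k)) atTop
      (𝓝 fun w ↦ ∑' k : Fin 3 → ℤ, c k * shintaniFn w Z (latSharp32 k)) :=
    tendsto_pi_nhds.mpr fun w ↦ (summable_term32 hb w Z).hasSum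
  have hm : Measurable fun w : ℍ ↦ ∑' k : Fin 3 → ℤ, c k * shintaniFn w Z (latSharp32 k) :=
    measurable_of_tendsto_metrizable' atTop
      (fun s ↦ (continuous_finsetSum s fun k _ ↦ hcont k).measurable) hlim
  have hsqrt : Measurable fun w : ℍ ↦ ((Real.sqrt z.im : ℝ) : ℂ) := measurable_const
  unfold genKernel32
  exact hsqrt.mul hm

end Measurability

/-! ### The generic lift -/

section Lift

variable (c : (Fin 3 → ℤ) → ℂ) (t : ℝ) (ht : 0 < t)

/-- The integrand `h_z(w) = φ(w) 𝒦₃₂[c,t](w, z)` of the generic theta lift. [cite: Shintani1975, §2 (2.1)] -/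
def liftIntegrandG (φ : ℍ → ℂ) (z w : ℍ) : ℂ := φ w * genKernel32 c t ht w z

/-- **`Γ₀(32)`-invariance of the integrand** for an invariant weight: `φ` has weight `2`,
`w ↦ 𝒦₃₂[c,t](w,z)` weight `-2`. [cite: Shintani1975, §2 (2.1), (2.12)] -/
theorem liftIntegrandG_smul {c : (Fin 3 → ℤ) → ℂ} (hinv : InvWeight32 c) (t : ℝ) (ht : 0 < t)
    (f : CuspForm (Gamma0 32) 2) (z : ℍ) {γ : SL(2, ℤ)} (hγ : γ ∈ Gamma0 32) (w : ℍ) :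
    liftIntegrandG c t ht f z (γ • w) = liftIntegrandG c t ht f z w := by
  unfold liftIntegrandG
  have hmem : (γ : GL (Fin 2) ℝ) ∈ (Gamma0 32 : Subgroup (GL (Fin 2) ℝ)) := ⟨γ, hγ, rfl⟩
  have h1 : f (γ • w) = (denom (γ : GL (Fin 2) ℝ) w) ^ (2 : ℤ) * f w := by
    have := SlashInvariantForm.slash_action_eqn'' f hmem w
    simpa using this
  have h32 : (32 : ℤ) ∣ γ 1 0 := by
    have h0 : ((γ 1 0 : ℤ) : ZMod 32) = 0 := Gamma0_mem.mp hγ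
    exact (ZMod.intCast_zmod_eq_zero_iff_dvd _ 32).mp h0
  have h2 := genKernel32_sl_smul hinv t ht γ h32 w z
  rw [ModularGroup.denom_apply] at h1
  rw [h1, zpow_ofNat]
  linear_combination (f w) * h2

/-- **The generic theta lift** `Φ[c,t](z) = ∫_{Γ₀(32)∖ℍ} φ(w) 𝒦₃₂[c,t](w, z) dμ(w)` (over the
fundamental domain `liftDomain32`). [cite: Shintani1975, §2 (2.1)] -/
def liftG (φ : ℍ → ℂ) (z : ℍ) : ℂ := ∫ w in liftDomain32, φ w * genKernel32 c t ht w z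

/-- **Automorphy of the lift from that of the kernel** (under the integral sign). [cite: Shintani1975, §2 Thm. 2] -/
theorem isThetaAutomorphic_liftG {N : ℕ} {χ : DirichletCharacter ℂ N}
    (hK : ∀ w : ℍ, IsThetaAutomorphic 3 N χ (fun z ↦ genKernel32 c t ht w z)) (φ : ℍ → ℂ) :
    IsThetaAutomorphic 3 N χ (liftG c t ht φ) := by
  intro γ hγ z
  unfold liftG
  rw [← integral_mul_const, ← integral_const_mul]
  congr 1
  funext w
  have hK' := hK w γ hγ z
  simp only at hK'
  linear_combination (φ w) * hK'

variable {c} in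
/-- **Integrability on a translate of the open fundamental domain** (bounded weight).
[cite: Shintani1975, §2, Prop. 2.1] -/
theorem integrableOn_liftIntegrandG_smul_fdo (hb : BddWeight c) (f : CuspForm (Gamma0 32) 2) (z : ℍ)
    (s : SL(2, ℤ)) : IntegrableOn (liftIntegrandG c t ht f z) {τ : ℍ | s • τ ∈ 𝒟ᵒ} := by
  set sG : GL (Fin 2) ℝ := (s : GL (Fin 2) ℝ) with hsG
  have hmp : MeasurePreserving (fun τ : ℍ ↦ sG • τ) volume volume := measurePreserving_smul _ _
  have hme : MeasurableEmbedding (fun τ : ℍ ↦ sG • τ) :=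
    (MeasurableEquiv.smul sG).measurableEmbedding
  have hset : {τ : ℍ | s • τ ∈ 𝒟ᵒ} = (fun τ : ℍ ↦ sG • τ) ⁻¹' 𝒟ᵒ := by
    ext τ; simp [hsG]
  have hfun : liftIntegrandG c t ht f z =
      (fun σ ↦ liftIntegrandG c t ht f z (sG⁻¹ • σ)) ∘ (fun τ : ℍ ↦ sG • τ) := by
    funext τ; simp
  rw [hset, hfun, hmp.integrableOn_comp_preimage hme]
  set a : SL(2, ℤ) := s⁻¹ with ha
  have haG : ∀ σ : ℍ, sG⁻¹ • σ = a • σ := by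
    intro σ
    simp [ha, hsG, ModularGroup.sl_moeb, map_inv]
  simp_rw [haG]
  obtain ⟨B, c₀, hc₀, hB0, hB⟩ := exists_decay_translate f a
  obtain ⟨Cz, hCz0, hCz⟩ := exists_norm_genKernel32_smul_le hb t ht z
  set M : ℝ := B * (Real.sqrt z.im * Cz) * (4 / c₀ ^ 2) with hM
  refine Measure.integrableOn_of_bounded (M := M)
    ((measure_mono ModularGroup.fdo_subset_fd).trans_lt volume_fd_lt_top).ne ?_ ?_
  · have hφ : Continuous fun σ : ℍ ↦ f (a • σ) :=
      (CuspFormClass.holo f).continuous.comp (continuous_sl2z_smul a)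
    have hK : Measurable fun σ : ℍ ↦ genKernel32 c t ht (a • σ) z :=
      (measurable_genKernel32 hb t ht z).comp (continuous_sl2z_smul a).measurable
    exact (hφ.measurable.mul hK).aestronglyMeasurable
  · rw [ae_restrict_iff' ModularGroup.isOpen_fdo.measurableSet]
    refine ae_of_all _ fun σ hσ ↦ ?_
    have hσ2 : 1 / 2 ≤ σ.im :=
      ((mem_verticalStrip_iff _ _ _).mp (fd_subset_verticalStrip (ModularGroup.fdo_subset_fd hσ))).2
    have hd0 : denom (a : GL (Fin 2) ℝ) σ ≠ 0 := denom_ne_zero _ _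
    have hdn : 0 < ‖denom (a : GL (Fin 2) ℝ) σ‖ := norm_pos_iff.mpr hd0
    unfold liftIntegrandG
    rw [norm_mul]
    have h1 := hB σ hσ2
    have h2 := hCz a σ hσ2
    have h3 := sq_mul_exp_neg_le hc₀ σ.im_pos.le
    calc ‖f (a • σ)‖ * ‖genKernel32 c t ht (a • σ) z‖
        ≤ (B * ‖denom (a : GL (Fin 2) ℝ) σ‖ ^ 2 * Real.exp (-c₀ * σ.im)) *
          (Real.sqrt z.im * (‖denom (a : GL (Fin 2) ℝ) σ‖ ^ 2)⁻¹ * (Cz * σ.im ^ 2)) :=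
          mul_le_mul h1 h2 (norm_nonneg _) (by positivity)
      _ = B * (Real.sqrt z.im * Cz) * (σ.im ^ 2 * Real.exp (-c₀ * σ.im)) := by
          field_simp
      _ ≤ B * (Real.sqrt z.im * Cz) * (4 / c₀ ^ 2) := by
          gcongr
      _ = M := by rw [hM]

variable {c} in
/-- **Integrability of the generic lift's integrand on the fundamental domain.** [cite: Shintani1975, §2, Prop. 2.1] -/
theorem integrableOn_liftIntegrandG (hb : BddWeight c) (f : CuspForm (Gamma0 32) 2) (z : ℍ) :
    IntegrableOn (liftIntegrandG c t ht f z) liftDomain32 := by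
  haveI := Fintype.ofFinite (↥𝒮ℒ ⧸ (Gamma0 32 : Subgroup (GL (Fin 2) ℝ)).subgroupOf 𝒮ℒ)
  unfold liftDomain32
  exact (integrableOn_finite_iUnion).mpr fun q ↦ integrableOn_liftIntegrandG_smul_fdo t ht hb f z (reps32 q)

/-- The lift as the integral of `liftIntegrandG`. [folklore] -/
theorem liftG_eq (φ : ℍ → ℂ) (z : ℍ) :
    liftG c t ht φ z = ∫ w in liftDomain32, liftIntegrandG c t ht φ z w := rfl

end Lift

end Literature.NumberTheory.EllipticCurves.Shintani

noncomputable section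

open scoped MatrixGroups ModularForm Modular Topology ENNReal Pointwise
open UpperHalfPlane hiding I
open Complex Filter MeasureTheory Set CongruenceSubgroup ModularGroup Real
open Literature.NumberTheory.EllipticCurves.ModularForms

namespace Literature.NumberTheory.EllipticCurves.Shintani

/-! ### Termwise integration -/

section Termwise

variable (c : (Fin 3 → ℤ) → ℂ) (t : ℝ) (ht : 0 < t)

/-- The `k`-th term of the generic lift's integrand: `φ(w) c(k) f_{w,tz}(ι♮₃₂ k)`. [folklore] -/
def liftTermG (φ : ℍ → ℂ) (z : ℍ) (k : Fin 3 → ℤ) (w : ℍ) : ℂ :=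
  φ w * (c k * shintaniFn w (mulPos t ht z) (latSharp32 k))

/-- The kernel integrand is `√(Im z)` times the sum of the terms. [folklore] -/
theorem liftIntegrandG_eq_tsum (φ : ℍ → ℂ) (z w : ℍ) :
    liftIntegrandG c t ht φ z w = (Real.sqrt z.im : ℂ) * ∑' k : Fin 3 → ℤ, liftTermG c t ht φ z k w := by
  simp only [liftTermG]
  rw [tsum_mul_left, liftIntegrandG, genKernel32]
  ring

/-- Each term is measurable in `w`. [folklore] -/
theorem measurable_liftTermG {φ : ℍ → ℂ} (hφ : Measurable φ) (z : ℍ) (k : Fin 3 → ℤ) :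
    Measurable (liftTermG c t ht φ z k) :=
  hφ.mul ((continuous_const.mul (continuous_shintaniFn_left (mulPos t ht z) (latSharp32 k))).measurable)

variable {c} in
/-- The pointwise bound for the sum of the norms of the terms on a translate (bounded weight). [folklore] -/
theorem exists_tsum_norm_weight_mul_le (hb : BddWeight c) (z : ℍ) :
    ∃ Cz : ℝ, 0 ≤ Cz ∧ ∀ (a : SL(2, ℤ)) (τ : ℍ), 1 / 2 ≤ τ.im →
      ∑' k : Fin 3 → ℤ, ‖c k * shintaniFn (a • τ) (mulPos t ht z) (latSharp32 k)‖ ≤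
        (‖denom (a : GL (Fin 2) ℝ) τ‖ ^ 2)⁻¹ * (Cz * τ.im ^ 2) := by
  obtain ⟨C, hC⟩ := hb
  have hC0 : 0 ≤ C := le_trans (norm_nonneg _) (hC 0)
  set Z : ℍ := mulPos t ht z with hZ
  have ha : 0 < 2 * π * Z.im := by have := Z.im_pos; positivity
  set C0 : ℝ := thetaZ (2 * ((2 * π * Z.im) / 2) * (1 / 2) ^ 2) * thetaZ ((2 * π * Z.im) / 2) *
      thetaZ (2 * ((2 * π * Z.im) / 2) / (1 / 2) ^ 2) / ((1 / 2) * Real.sqrt (2 * (2 * π * Z.im))) with hC0def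
  have hC00 : 0 ≤ C0 := by
    rw [hC0def]
    refine div_nonneg (mul_nonneg (mul_nonneg (thetaZ_nonneg _) (thetaZ_nonneg _)) (thetaZ_nonneg _)) ?_
    positivity
  refine ⟨C * C0, mul_nonneg hC0 hC00, fun a τ hτ ↦ ?_⟩
  obtain ⟨hS, hB⟩ := tsum_norm_formEval_mul_exp_le ha (half_pos one_pos) τ hτ
  have hs1 : Summable fun k : Fin 3 → ℤ ↦ ‖shintaniFn (a • τ) Z (latSharp32 k)‖ := by
    have := summable_term32 (c := fun _ ↦ (1 : ℂ)) ⟨1, fun _ ↦ by simp⟩ (a • τ) Z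
    simpa using this.norm
  have hsum := summable_term32 ⟨C, hC⟩ (a • τ) Z
  calc ∑' k : Fin 3 → ℤ, ‖c k * shintaniFn (a • τ) Z (latSharp32 k)‖
      ≤ ∑' k : Fin 3 → ℤ, C * ‖shintaniFn (a • τ) Z (latSharp32 k)‖ := by
        refine Summable.tsum_le_tsum (fun k ↦ ?_) hsum.norm (hs1.mul_left C)
        rw [norm_mul]
        exact mul_le_mul_of_nonneg_right (hC k) (norm_nonneg _)
    _ = C * ∑' k : Fin 3 → ℤ, ‖shintaniFn (a • τ) Z (latSharp32 k)‖ := tsum_mul_left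
    _ ≤ C * ((‖denom (a : GL (Fin 2) ℝ) τ‖ ^ 2)⁻¹ * (C0 * τ.im ^ 2)) := by
        refine mul_le_mul_of_nonneg_left ?_ hC0
        exact (tsum_norm_shintaniFn_smul_le32 a τ Z).trans (mul_le_mul_of_nonneg_left hB (by positivity))
    _ = _ := by ring

variable {c} in
/-- **Finiteness of `∑_k ∫ ‖term_k‖` on a translate of `𝒟ᵒ`.** [cite: Shintani1975, §2, Prop. 2.1] -/
theorem lintegral_tsum_enorm_liftTermG_smul_fdo_lt_top (hb : BddWeight c) (f : CuspForm (Gamma0 32) 2) (z : ℍ)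
    (s : SL(2, ℤ)) :
    ∫⁻ τ in {τ : ℍ | s • τ ∈ 𝒟ᵒ}, ∑' k : Fin 3 → ℤ, ‖liftTermG c t ht f z k τ‖ₑ < ∞ := by
  set sG : GL (Fin 2) ℝ := (s : GL (Fin 2) ℝ) with hsG
  have hmp : MeasurePreserving (fun τ : ℍ ↦ sG • τ) volume volume := measurePreserving_smul _ _
  have hme : MeasurableEmbedding (fun τ : ℍ ↦ sG • τ) :=
    (MeasurableEquiv.smul sG).measurableEmbedding
  have hset : {τ : ℍ | s • τ ∈ 𝒟ᵒ} = (fun τ : ℍ ↦ sG • τ) ⁻¹' 𝒟ᵒ := by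
    ext τ; simp [hsG]
  set G : ℍ → ℝ≥0∞ := fun τ ↦ ∑' k : Fin 3 → ℤ, ‖liftTermG c t ht f z k τ‖ₑ with hGdef
  change ∫⁻ τ in {τ : ℍ | s • τ ∈ 𝒟ᵒ}, G τ < ∞
  have h2 : ∫⁻ τ in (fun τ : ℍ ↦ sG • τ) ⁻¹' 𝒟ᵒ, G τ = ∫⁻ σ in 𝒟ᵒ, G (sG⁻¹ • σ) := by
    have := hmp.setLIntegral_comp_preimage_emb hme (fun σ ↦ G (sG⁻¹ • σ)) 𝒟ᵒ
    simp only [inv_smul_smul] at this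
    exact this
  rw [hset, h2]
  set a : SL(2, ℤ) := s⁻¹ with ha
  have haG : ∀ σ : ℍ, sG⁻¹ • σ = a • σ := by
    intro σ
    simp [ha, hsG, ModularGroup.sl_moeb, map_inv]
  simp_rw [haG]
  obtain ⟨B, c₀, hc, hB0, hB⟩ := exists_decay_translate f a
  obtain ⟨Cz, hCz0, hCz⟩ := exists_tsum_norm_weight_mul_le t ht hb z
  set M : ℝ := B * Cz * (4 / c₀ ^ 2) with hM
  have hpt : ∀ σ ∈ 𝒟ᵒ, G (a • σ) ≤ ENNReal.ofReal M := by
    intro σ hσ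
    have hσ2 : 1 / 2 ≤ σ.im :=
      ((mem_verticalStrip_iff _ _ _).mp (fd_subset_verticalStrip (ModularGroup.fdo_subset_fd hσ))).2
    have hd0 : denom (a : GL (Fin 2) ℝ) σ ≠ 0 := denom_ne_zero _ _
    have hdn : 0 < ‖denom (a : GL (Fin 2) ℝ) σ‖ := norm_pos_iff.mpr hd0
    have h1 := hB σ hσ2
    have h2 := hCz a σ hσ2
    have h3 := sq_mul_exp_neg_le hc σ.im_pos.le
    have hsum : Summable fun k : Fin 3 → ℤ ↦ ‖c k * shintaniFn (a • σ) (mulPos t ht z) (latSharp32 k)‖ :=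
      (summable_term32 hb (a • σ) (mulPos t ht z)).norm
    have hG : G (a • σ) = ENNReal.ofReal (‖f (a • σ)‖ *
        ∑' k : Fin 3 → ℤ, ‖c k * shintaniFn (a • σ) (mulPos t ht z) (latSharp32 k)‖) := by
      rw [hGdef]
      simp only [liftTermG]
      rw [← tsum_mul_left, ENNReal.ofReal_tsum_of_nonneg (fun k ↦ by positivity) (hsum.mul_left _)]
      refine tsum_congr fun k ↦ ?_
      rw [← norm_mul, ofReal_norm]
    rw [hG]
    refine ENNReal.ofReal_le_ofReal ?_
    calc ‖f (a • σ)‖ * ∑' k : Fin 3 → ℤ, ‖c k * shintaniFn (a • σ) (mulPos t ht z) (latSharp32 k)‖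
        ≤ (B * ‖denom (a : GL (Fin 2) ℝ) σ‖ ^ 2 * Real.exp (-c₀ * σ.im)) *
          ((‖denom (a : GL (Fin 2) ℝ) σ‖ ^ 2)⁻¹ * (Cz * σ.im ^ 2)) :=
          mul_le_mul h1 h2 (tsum_nonneg fun _ ↦ norm_nonneg _) (by positivity)
      _ = B * Cz * (σ.im ^ 2 * Real.exp (-c₀ * σ.im)) := by field_simp
      _ ≤ B * Cz * (4 / c₀ ^ 2) := by gcongr
      _ = M := by rw [hM]
  calc ∫⁻ σ in 𝒟ᵒ, G (a • σ) ≤ ∫⁻ _ in 𝒟ᵒ, ENNReal.ofReal M :=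
        setLIntegral_mono measurable_const hpt
    _ = ENNReal.ofReal M * volume 𝒟ᵒ := setLIntegral_const _ _
    _ < ∞ := by
        refine ENNReal.mul_lt_top ENNReal.ofReal_lt_top ?_
        exact (measure_mono ModularGroup.fdo_subset_fd).trans_lt volume_fd_lt_top

variable {c} in
/-- **Finiteness of `∑_k ∫_F ‖term_k‖`** on the whole domain `F`. [cite: Shintani1975, §2, Prop. 2.1] -/
theorem tsum_lintegral_enorm_liftTermG_ne_top (hb : BddWeight c) (f : CuspForm (Gamma0 32) 2) (z : ℍ) :
    ∑' k : Fin 3 → ℤ, ∫⁻ w in liftDomain32, ‖liftTermG c t ht f z k w‖ₑ ≠ ∞ := by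
  haveI := Fintype.ofFinite (↥𝒮ℒ ⧸ (Gamma0 32 : Subgroup (GL (Fin 2) ℝ)).subgroupOf 𝒮ℒ)
  have hmeas : ∀ k, Measurable (liftTermG c t ht f z k) :=
    fun k ↦ measurable_liftTermG c t ht (CuspFormClass.holo f).continuous.measurable z k
  rw [← lintegral_tsum fun k ↦ (hmeas k).enorm.aemeasurable]
  refine ne_of_lt ?_
  unfold liftDomain32
  calc ∫⁻ w in ⋃ q, {τ : ℍ | reps32 q • τ ∈ 𝒟ᵒ}, ∑' k, ‖liftTermG c t ht f z k w‖ₑ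
      ≤ ∑ q, ∫⁻ w in {τ : ℍ | reps32 q • τ ∈ 𝒟ᵒ}, ∑' k, ‖liftTermG c t ht f z k w‖ₑ := by
        refine (lintegral_iUnion_le _ _).trans ?_
        rw [tsum_fintype]
    _ < ∞ := by
        refine ENNReal.sum_lt_top.mpr fun q _ ↦ ?_
        exact lintegral_tsum_enorm_liftTermG_smul_fdo_lt_top t ht hb f z (reps32 q)

variable {c} in
/-- **Termwise integration**: `Φ[c,t](z) = √(Im z) ∑_k ∫_F φ(w) c(k) f_{w,tz}(ι♮₃₂ k) dμ(w)`.
[cite: Shintani1975, §2, (2.8)–(2.9)] -/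
theorem liftG_eq_tsum_integral (hb : BddWeight c) (f : CuspForm (Gamma0 32) 2) (z : ℍ) :
    liftG c t ht f z = (Real.sqrt z.im : ℂ) * ∑' k : Fin 3 → ℤ, ∫ w in liftDomain32, liftTermG c t ht f z k w := by
  have hmeas : ∀ k, Measurable (liftTermG c t ht f z k) :=
    fun k ↦ measurable_liftTermG c t ht (CuspFormClass.holo f).continuous.measurable z k
  rw [liftG_eq]
  simp_rw [liftIntegrandG_eq_tsum]
  rw [integral_const_mul, integral_tsum (fun k ↦ (hmeas k).aestronglyMeasurable)
    (tsum_lintegral_enorm_liftTermG_ne_top t ht hb f z)]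

end Termwise

/-! ### Unfolding orbit by orbit for the generic terms -/

section Unfolding

variable (c : (Fin 3 → ℤ) → ℂ) (t : ℝ) (ht : 0 < t)

/-- **`term(γ • k)(w) = term(k)(γ⁻¹ w)`** for `γ ∈ Γ₀(32)⁺`, `φ ∈ S₂(Γ₀(32))`, `c` invariant.
[cite: Shintani1975, (2.12)] -/
theorem liftTermG_smul {c : (Fin 3 → ℤ) → ℂ} (hinv : InvWeight32 c) (t : ℝ) (ht : 0 < t)
    (f : CuspForm (Gamma0 32) 2) (z : ℍ) (γ : Gamma0Plus 32)
    (k : Fin 3 → ℤ) (w : ℍ) :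
    liftTermG c t ht f z (γ • k) w = liftTermG c t ht f z k (((γ : SL(2, ℤ))⁻¹) • w) := by
  unfold liftTermG
  set g : SL(2, ℤ) := (γ : SL(2, ℤ))⁻¹ with hg
  have hgmem : g ∈ Gamma0 32 := (Gamma0 32).inv_mem (Gamma0Plus_le γ.2)
  have hmem : (g : GL (Fin 2) ℝ) ∈ (Gamma0 32 : Subgroup (GL (Fin 2) ℝ)) := ⟨g, hgmem, rfl⟩
  have h1 : f (g • w) = (denom (g : GL (Fin 2) ℝ) w) ^ (2 : ℤ) * f w := by
    have := SlashInvariantForm.slash_action_eqn'' f hmem w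
    simpa using this
  rw [ModularGroup.denom_apply] at h1
  rw [invWeight32_smul hinv, shintaniFn_latSharp32_smul, ← hg, h1, zpow_ofNat]
  ring

/-- The term integrals `k ↦ ∫_F term_k` are absolutely summable. [folklore] -/
theorem summable_norm_integral_liftTermG {c : (Fin 3 → ℤ) → ℂ} (hb : BddWeight c) (t : ℝ) (ht : 0 < t)
    (f : CuspForm (Gamma0 32) 2) (z : ℍ) :
    Summable fun k : Fin 3 → ℤ ↦ ‖∫ w in liftDomain32, liftTermG c t ht f z k w‖ := by
  have h := tsum_lintegral_enorm_liftTermG_ne_top t ht hb f z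
  have hle : ∀ k, ‖∫ w in liftDomain32, liftTermG c t ht f z k w‖ ≤
      (∫⁻ w in liftDomain32, ‖liftTermG c t ht f z k w‖ₑ).toReal := by
    intro k
    refine (norm_integral_le_lintegral_norm _).trans (le_of_eq ?_)
    congr 1
    refine lintegral_congr fun w ↦ ?_
    rw [ofReal_norm]
  refine Summable.of_nonneg_of_le (fun _ ↦ norm_nonneg _) hle ?_
  exact ENNReal.summable_toReal h

/-- Each term is integrable on `F`. [folklore] -/
theorem integrableOn_liftTermG {c : (Fin 3 → ℤ) → ℂ} (hb : BddWeight c) (t : ℝ) (ht : 0 < t)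
    (f : CuspForm (Gamma0 32) 2) (z : ℍ) (k : Fin 3 → ℤ) :
    IntegrableOn (liftTermG c t ht f z k) liftDomain32 := by
  have hmeas : Measurable (liftTermG c t ht f z k) :=
    measurable_liftTermG c t ht (CuspFormClass.holo f).continuous.measurable z k
  refine ⟨hmeas.aestronglyMeasurable, ?_⟩
  rw [hasFiniteIntegral_iff_enorm]
  exact lt_top_iff_ne_top.mpr (ENNReal.ne_top_of_tsum_ne_top (tsum_lintegral_enorm_liftTermG_ne_top t ht hb f z) k)

/-- `∫_F ‖term_k‖` as the real part of the finite `lintegral`. [folklore] -/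
theorem integral_norm_liftTermG_eq_toReal {c : (Fin 3 → ℤ) → ℂ} (hb : BddWeight c) (t : ℝ) (ht : 0 < t)
    (f : CuspForm (Gamma0 32) 2) (z : ℍ) (k : Fin 3 → ℤ) :
    ∫ w in liftDomain32, ‖liftTermG c t ht f z k w‖ = (∫⁻ w in liftDomain32, ‖liftTermG c t ht f z k w‖ₑ).toReal := by
  rw [integral_norm_eq_lintegral_enorm (integrableOn_liftTermG hb t ht f z k).aestronglyMeasurable]

/-- The integrals of the norms of the terms are summable. [folklore] -/
theorem summable_integral_norm_liftTermG {c : (Fin 3 → ℤ) → ℂ} (hb : BddWeight c) (t : ℝ) (ht : 0 < t)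
    (f : CuspForm (Gamma0 32) 2) (z : ℍ) :
    Summable fun k : Fin 3 → ℤ ↦ ∫ w in liftDomain32, ‖liftTermG c t ht f z k w‖ := by
  simp_rw [integral_norm_liftTermG_eq_toReal hb t ht]
  exact ENNReal.summable_toReal (tsum_lintegral_enorm_liftTermG_ne_top t ht hb f z)

/-- **The orbit identity** at level `32`: `∑_{q ∈ Γ/Γ_{k₀}} ∫_F term(q.out • k₀) = ∫_{F_{k₀}} term(k₀)`,
with `term(k₀)` integrable on `F_{k₀}`. [cite: Shintani1975, §2, (2.9)] -/
theorem tsum_quotient_integral_liftTermG_eq {c : (Fin 3 → ℤ) → ℂ} (hinv : InvWeight32 c) (hb : BddWeight c)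
    (t : ℝ) (ht : 0 < t) (f : CuspForm (Gamma0 32) 2) (z : ℍ)
    (k₀ : Fin 3 → ℤ) :
    IntegrableOn (liftTermG c t ht f z k₀) (orbitDomain32 k₀) ∧
    ∑' q : Gamma0Plus 32 ⧸ stabK32 k₀, ∫ w in liftDomain32, liftTermG c t ht f z (q.out • k₀) w =
      ∫ w in orbitDomain32 k₀, liftTermG c t ht f z k₀ w := by
  haveI : Countable (cosetRepInv32 k₀) := Subtype.countable
  set ψ := liftTermG c t ht f z k₀ with hψ
  have hterm : ∀ q : Gamma0Plus 32 ⧸ stabK32 k₀, ∀ w,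
      liftTermG c t ht f z (q.out • k₀) w = ψ ((q.out)⁻¹ • w) := by
    intro q w
    rw [liftTermG_smul hinv t ht, coe_inv_smul32]
  have hint_piece : ∀ r : cosetRepInv32 k₀, IntegrableOn ψ ((r : Gamma0Plus 32) • liftDomain32) := by
    rintro ⟨r, q, rfl⟩
    rw [integrableOn_smul_set_iff32]
    have := integrableOn_liftTermG hb t ht f z (q.out • k₀)
    refine this.congr_fun (fun w _ ↦ ?_) measurableSet_liftDomain32
    exact hterm q w
  have hsum_piece : Summable fun r : cosetRepInv32 k₀ ↦ ∫ w in (r : Gamma0Plus 32) • liftDomain32, ‖ψ w‖ := by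
    have h1 : Summable fun q : Gamma0Plus 32 ⧸ stabK32 k₀ ↦
        ∫ w in liftDomain32, ‖liftTermG c t ht f z (q.out • k₀) w‖ := by
      have hinj : Function.Injective fun q : Gamma0Plus 32 ⧸ stabK32 k₀ ↦ q.out • k₀ := by
        intro q q' h
        have hmem : (q'.out)⁻¹ * q.out ∈ stabK32 k₀ := by
          rw [MulAction.mem_stabilizer_iff, mul_smul (q'.out)⁻¹ q.out k₀]
          have h' : q.out • k₀ = q'.out • k₀ := h
          rw [h', inv_smul_smul]
        have := QuotientGroup.eq.mpr hmem
        rw [QuotientGroup.out_eq', QuotientGroup.out_eq'] at this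
        exact this.symm
      exact (summable_integral_norm_liftTermG hb t ht f z).comp_injective hinj
    refine (quotEquivCosetRepInv32 k₀).summable_iff.mp ?_
    convert h1 using 1
    funext q
    simp only [Function.comp_apply, quotEquivCosetRepInv32, Equiv.ofBijective_apply]
    rw [setIntegral_smul_set32]
    refine integral_congr_ae (Eventually.of_forall fun w ↦ ?_)
    simp only [hterm q w]
  have hint : IntegrableOn ψ (orbitDomain32 k₀) := by
    rw [orbitDomain32, biUnion_eq_iUnion]
    exact integrableOn_iUnion_of_summable_integral_norm hint_piece hsum_piece
  refine ⟨hint, ?_⟩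
  rw [orbitDomain32, setIntegral_iUnion_smul_eq_tsum isFundamentalDomain_liftDomain32 (cosetRepInv32 k₀)
    (by simpa only [orbitDomain32] using hint)]
  rw [← (quotEquivCosetRepInv32 k₀).tsum_eq]
  refine tsum_congr fun q ↦ ?_
  simp only [quotEquivCosetRepInv32, Equiv.ofBijective_apply]
  refine integral_congr_ae (Eventually.of_forall fun w ↦ ?_)
  exact hterm q w

/-- **Invariance of `term(k₀)` under the stabiliser of `k₀`.** [folklore] -/
theorem liftTermG_stab_invariant {c : (Fin 3 → ℤ) → ℂ} (hinv : InvWeight32 c) (t : ℝ) (ht : 0 < t)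
    (f : CuspForm (Gamma0 32) 2) (z : ℍ) (k₀ : Fin 3 → ℤ)
    (γ : stabK32 k₀) (w : ℍ) : liftTermG c t ht f z k₀ (γ • w) = liftTermG c t ht f z k₀ w := by
  have hfix : (γ : Gamma0Plus 32) • k₀ = k₀ := γ.2
  have h := liftTermG_smul hinv t ht f z (γ : Gamma0Plus 32) k₀ (γ • w)
  rw [hfix] at h
  rw [h]
  congr 1
  show ((γ : Gamma0Plus 32) : SL(2, ℤ))⁻¹ • (((γ : Gamma0Plus 32) : SL(2, ℤ)) • w) = w
  rw [inv_smul_smul]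

end Unfolding

end Literature.NumberTheory.EllipticCurves.Shintani

noncomputable section

open scoped MatrixGroups ModularForm Modular Topology ENNReal Pointwise Manifold
open UpperHalfPlane hiding I
open Complex Filter MeasureTheory Set CongruenceSubgroup ModularGroup Real MulAction
open Literature.NumberTheory.EllipticCurves.ModularForms

namespace Literature.NumberTheory.EllipticCurves.Shintani

/-! ### Null orbits vanish -/

section NullOrbits

variable (c : (Fin 3 → ℤ) → ℂ) (t : ℝ) (ht : 0 < t)

/-- **The term after moving to the strip**: with `ι♮₃₂(k₀) ∘ σ⁻¹ = λ Y²`,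
`term(k₀)(σ⁻¹ u) = (φ|σ⁻¹)(u) · c_D(k₀) λ e^{-4π Im Z λ²/(Im u)²}`. [folklore] -/
theorem liftTermG_sigma_inv_smul (f : CuspForm (Gamma0 32) 2) (z : ℍ) {k₀ : Fin 3 → ℤ} {σ : SL(2, ℤ)}
    {lam : ℝ} (hσ : actM σ⁻¹ (latSharp32 k₀) = yTwo lam) (u : ℍ) :
    liftTermG c t ht f z k₀ (σ⁻¹ • u) = (⇑f ∣[(2 : ℤ)] σ⁻¹) u * (c k₀ * ((lam : ℂ) *
      cexp (((-(4 * π * (mulPos t ht z).im * lam ^ 2 / u.im ^ 2) : ℝ) : ℂ)))) := by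
  set g : SL(2, ℤ) := σ⁻¹ with hg
  have hj : (((g 1 0 : ℤ) : ℂ) * u + ((g 1 1 : ℤ) : ℂ)) ≠ 0 := by
    have h := UpperHalfPlane.denom_ne_zero (g : GL (Fin 2) ℝ) u
    rw [ModularGroup.denom_apply] at h
    exact_mod_cast h
  have h1 := shintaniFn_sl_smul g u (mulPos t ht z) (latSharp32 k₀)
  have h2 : actV (g 0 0 : ℤ) (g 0 1 : ℤ) (g 1 0 : ℤ) (g 1 1 : ℤ) (latSharp32 k₀) = yTwo lam := hσ
  rw [h2, shintaniFn_yTwo] at h1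
  have h3 : (⇑f ∣[(2 : ℤ)] g) u = f (g • u) * (((g 1 0 : ℤ) : ℂ) * u + ((g 1 1 : ℤ) : ℂ)) ^ (-(2 : ℤ)) := by
    rw [ModularForm.SL_slash_apply, ModularGroup.denom_apply]
  unfold liftTermG
  rw [h3]
  have h4 : shintaniFn (g • u) (mulPos t ht z) (latSharp32 k₀) =
      ((lam : ℂ) * cexp (((-(4 * π * (mulPos t ht z).im * lam ^ 2 / u.im ^ 2) : ℝ) : ℂ))) /
        (((g 1 0 : ℤ) : ℂ) * u + ((g 1 1 : ℤ) : ℂ)) ^ 2 := by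
    rw [eq_div_iff (pow_ne_zero 2 hj), mul_comm, ← h1]
  rw [h4, _root_.zpow_neg, zpow_ofNat]
  field_simp




/-- **The orbit of a non-zero null vector contributes `0`** (level `32`). [cite: Shintani1975, §2,
proof of Prop. 2.3 (p. 103)] -/
theorem integral_orbitDomainG_eq_zero_of_null {c : (Fin 3 → ℤ) → ℂ} (hinv : InvWeight32 c) (hb : BddWeight c)
    (t : ℝ) (ht : 0 < t) (f : CuspForm (Gamma0 32) 2) (z : ℍ)
    {k₀ : Fin 3 → ℤ} (hnull : disc (latSharp32 k₀) = 0) (hk : k₀ ≠ 0) :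
    ∫ w in orbitDomain32 k₀, liftTermG c t ht f z k₀ w = 0 := by
  obtain ⟨σ, lam, n₀, m, hlam, hn₀, hσ, hm, hact, hTmem⟩ := null_stabilizer32 hnull hk
  have hn₀R : (0 : ℝ) < n₀ := by exact_mod_cast hn₀
  have hFD := isFundamentalDomain_orbitDomain32 k₀
  have hFD' : IsFundamentalDomain (stabK32 k₀) (σ⁻¹ • hstrip (n₀ : ℝ)) (volume : Measure ℍ) := by
    refine isFundamentalDomain_conj_hstrip σ hn₀R m hm (fun γ w ↦ ?_)
    have h := hact γ w
    push_cast at h ⊢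
    exact h
  have hstab : ∀ (γ : stabK32 k₀) (w : ℍ), liftTermG c t ht f z k₀ (γ • w) = liftTermG c t ht f z k₀ w :=
    liftTermG_stab_invariant hinv t ht f z k₀
  obtain ⟨hint, -⟩ := tsum_quotient_integral_liftTermG_eq hinv hb t ht f z k₀
  rw [hFD.setIntegral_eq hFD' hstab, setIntegral_sl_smul_set]
  have hint' : IntegrableOn (fun u ↦ liftTermG c t ht f z k₀ (σ⁻¹ • u)) (hstrip (n₀ : ℝ)) := by
    rw [← integrableOn_sl_smul_set_iff]
    exact (hFD.integrableOn_iff hFD' hstab).mp hint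
  simp_rw [liftTermG_sigma_inv_smul c t ht f z hσ] at hint' ⊢
  set G : ℝ → ℂ := fun v ↦ c k₀ * ((lam : ℂ) *
    cexp (((-(4 * π * (mulPos t ht z).im * lam ^ 2 / v ^ 2) : ℝ) : ℂ))) with hG
  obtain ⟨hhol, hzero⟩ := mdifferentiable_and_isZeroAtImInfty_slash32 f σ⁻¹
  have hper : ∀ u : ℍ, (⇑f ∣[(2 : ℤ)] σ⁻¹) (((n₀ : ℝ)) +ᵥ u) = (⇑f ∣[(2 : ℤ)] σ⁻¹) u := by
    intro u
    have := slash_vadd_of_conj_T_mem32 f σ (n := (n₀ : ℤ)) (Gamma0Plus_le hTmem) u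
    exact_mod_cast this
  exact setIntegral_hstrip_mul_eq_zero (⇑f ∣[(2 : ℤ)] σ⁻¹) hhol hn₀R hper hzero G hint'

end NullOrbits

/-! ### Definite orbits vanish -/

section Definite

variable (c : (Fin 3 → ℤ) → ℂ) (t : ℝ) (ht : 0 < t)

/-- **The orbit of a definite vector contributes `0`** (level `32`): trivial stabiliser, the
substitution adapted to the root, and Cauchy's theorem on the disc (`CayleyDefiniteVanishing`).
[cite: Shintani1975, §2, proof of Prop. 2.3 (p. 103)] -/
theorem integral_orbitDomainG_eq_zero_of_disc_neg {c : (Fin 3 → ℤ) → ℂ} (hinv : InvWeight32 c) (hb : BddWeight c)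
    (t : ℝ) (ht : 0 < t) (f : CuspForm (Gamma0 32) 2) (z : ℍ)
    {k₀ : Fin 3 → ℤ} (hneg : disc (latSharp32 k₀) < 0) :
    ∫ w in orbitDomain32 k₀, liftTermG c t ht f z k₀ w = 0 := by
  haveI : Subsingleton (stabK32 k₀) := ⟨fun a b ↦ Subtype.ext
    ((eq_one_of_smul_eq_of_disc_neg32 hneg a.2).trans (eq_one_of_smul_eq_of_disc_neg32 hneg b.2).symm)⟩
  have hFD := isFundamentalDomain_orbitDomain32 k₀
  have hFD' : IsFundamentalDomain (stabK32 k₀) (univ : Set ℍ) (volume : Measure ℍ) :=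
    isFundamentalDomain_univ_of_subsingleton
  have hstab : ∀ (γ : stabK32 k₀) (w : ℍ), liftTermG c t ht f z k₀ (γ • w) = liftTermG c t ht f z k₀ w :=
    liftTermG_stab_invariant hinv t ht f z k₀
  obtain ⟨hint, -⟩ := tsum_quotient_integral_liftTermG_eq hinv hb t ht f z k₀
  rw [hFD.setIntegral_eq hFD' hstab, Measure.restrict_univ]
  have hintU : Integrable (liftTermG c t ht f z k₀) := by
    have := (hFD.integrableOn_iff hFD' hstab).mp hint
    rwa [integrableOn_univ] at this
  set x : V := latSharp32 k₀ with hxdef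
  have hx0 : x 0 ≠ 0 := by
    intro h0
    have : disc x = x 1 ^ 2 := by rw [disc, h0]; ring
    rw [this] at hneg
    nlinarith [sq_nonneg (x 1)]
  obtain ⟨u, v, hv, h1, h2⟩ := exists_root_of_disc_neg hx0 hneg
  rw [← integral_comp_gl_smul (gAff u v hv)]
  have hintG : Integrable fun w ↦ liftTermG c t ht f z k₀ ((gAff u v hv) • w) :=
    (integrable_comp_gl_smul_iff _ _).mpr hintU
  set Z : ℍ := mulPos t ht z with hZ
  set A : ℂ := ((x 0 * v ^ 2 : ℝ) : ℂ) * cexp (2 * π * I * ((Z : ℂ).re * disc x + I * ((Z : ℂ).im * disc x))) with hA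
  set G : ℝ → ℂ := fun s ↦ cexp ((-(4 * π * (Z : ℂ).im * (x 0) ^ 2 * v ^ 2 * s ^ 2) : ℝ)) with hG
  set ψ : ℂ → ℂ := fun w ↦ f ((gAff u v hv) • UpperHalfPlane.ofComplex w) * (c k₀ * A) with hψ
  have hpt : ∀ w : ℍ, liftTermG c t ht f z k₀ ((gAff u v hv) • w) =
      ψ w * (((w : ℂ)) ^ 2 + 1) * G ((Complex.normSq (w : ℂ) + 1) / w.im) := by
    intro w
    rw [liftTermG, ← hZ, ← hxdef, shintaniFn_gAff_smul hv h1 h2 w Z, hψ, hG, hA]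
    simp only [UpperHalfPlane.ofComplex_apply]
    ring
  simp_rw [hpt] at hintG ⊢
  rw [← setIntegral_univ, FdCoord.setIntegral_eq_setIntegral_image _ MeasurableSet.univ, image_univ,
    UpperHalfPlane.range_coe]
  have hintC := (FdCoord.integrableOn_image_iff
    (fun w : ℍ ↦ ψ w * (((w : ℂ)) ^ 2 + 1) * G ((Complex.normSq (w : ℂ) + 1) / w.im)) MeasurableSet.univ).mpr
    (by rwa [integrableOn_univ])
  rw [image_univ, UpperHalfPlane.range_coe] at hintC
  have hshape : ∀ w ∈ {z : ℂ | 0 < z.im},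
      ((1 / w.im ^ 2 : ℝ) : ℂ) * (ψ (UpperHalfPlane.ofComplex w) * ((((UpperHalfPlane.ofComplex w : ℍ) : ℂ)) ^ 2 + 1) *
        G ((Complex.normSq ((UpperHalfPlane.ofComplex w : ℍ) : ℂ) + 1) / (UpperHalfPlane.ofComplex w).im)) =
      ((1 / w.im ^ 2 : ℝ) : ℂ) * (ψ w * (w ^ 2 + 1) * G ((Complex.normSq w + 1) / w.im)) := by
    intro w hw
    have hw' : 0 < w.im := hw
    rw [UpperHalfPlane.ofComplex_apply_of_im_pos hw']
    rfl
  rw [setIntegral_congr_fun (isOpen_lt continuous_const Complex.continuous_im).measurableSet hshape]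
  have hintC' : IntegrableOn (fun w : ℂ ↦ ((1 / w.im ^ 2 : ℝ) : ℂ) * (ψ w * (w ^ 2 + 1) *
      G ((Complex.normSq w + 1) / w.im))) {z : ℂ | 0 < z.im} :=
    hintC.congr_fun hshape (isOpen_lt continuous_const Complex.continuous_im).measurableSet
  have hψdiff : DifferentiableOn ℂ ψ {z : ℂ | 0 < z.im} := by
    have hf : DifferentiableOn ℂ (⇑f ∘ UpperHalfPlane.ofComplex) {z : ℂ | 0 < z.im} :=
      UpperHalfPlane.mdifferentiable_iff.mp (CuspFormClass.holo f)
    have haff : DifferentiableOn ℂ (fun w : ℂ ↦ (v : ℂ) * w + u) {z : ℂ | 0 < z.im} := by fun_prop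
    have hmaps : MapsTo (fun w : ℂ ↦ (v : ℂ) * w + u) {z : ℂ | 0 < z.im} {z : ℂ | 0 < z.im} := by
      intro w hw
      show 0 < ((v : ℂ) * w + u).im
      simpa using mul_pos hv hw
    have hcomp := hf.comp haff hmaps
    refine ((hcomp.mul_const (c k₀ * A)).congr fun w hw ↦ ?_)
    simp only [hψ, Function.comp_apply]
    rw [gAff_smul_ofComplex hv hw]
  refine setIntegral_uhp_definite_eq_zero hψdiff G ?_
  have hball := (integrableOn_uhp_iff_integrableOn_ball _).mp hintC'
  set H : ℝ → ℂ := fun r ↦ -8 * G (2 * (1 + r ^ 2) / (1 - r ^ 2)) / (((1 - r ^ 2) ^ 2 : ℝ) : ℂ) / I with hH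
  set Ψ : ℂ → ℂ := fun ζ ↦ ψ (cayInv ζ) * (2 * I / (1 - ζ) ^ 2) with hΨ
  have hball' : IntegrableOn (fun ζ ↦ H ‖ζ‖ * (ζ * Ψ ζ)) (Metric.ball (0 : ℂ) 1) := by
    refine hball.congr_fun (fun ζ hζ ↦ ?_) Metric.isOpen_ball.measurableSet
    rw [hH, hΨ]
    exact disc_integrand_eq ψ G hζ
  have hGc : Continuous G := by rw [hG]; fun_prop
  have hψc : ContinuousOn ψ {z : ℂ | 0 < z.im} := hψdiff.continuousOn
  have hcay : ContinuousOn cayInv (Metric.ball (0 : ℂ) 1) := by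
    intro ζ hζ
    exact (hasDerivAt_cayInv (one_sub_ne_zero_of_mem_ball hζ)).continuousAt.continuousWithinAt
  have hcont : ContinuousOn (fun ζ ↦ H ‖ζ‖ * (ζ * Ψ ζ)) (Metric.ball (0 : ℂ) 1) := by
    refine ContinuousOn.mul ?_ (continuousOn_id.mul ?_)
    · rw [hH]
      refine ContinuousOn.div_const ?_ _
      refine ContinuousOn.div ?_ ?_ (fun ζ hζ ↦ ?_)
      · refine continuousOn_const.mul (hGc.comp_continuousOn ?_)
        refine ContinuousOn.div (by fun_prop) (by fun_prop) (fun ζ hζ ↦ ?_)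
        rw [Metric.mem_ball, dist_zero_right] at hζ
        nlinarith [norm_nonneg ζ]
      · fun_prop
      · rw [Metric.mem_ball, dist_zero_right] at hζ
        have : (1 : ℝ) - ‖ζ‖ ^ 2 ≠ 0 := by nlinarith [norm_nonneg ζ]
        exact_mod_cast pow_ne_zero 2 this
    · rw [hΨ]
      refine ContinuousOn.mul (hψc.comp hcay (fun ζ hζ ↦ cayInv_im_pos hζ)) ?_
      refine ContinuousOn.div continuousOn_const (by fun_prop) (fun ζ hζ ↦ ?_)
      exact pow_ne_zero 2 (one_sub_ne_zero_of_mem_ball hζ)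
  have hpol := integrableOn_polar_of_continuousOn hcont hball'
  refine hpol.congr_fun (fun p hp ↦ ?_) (measurableSet_Ioo.prod measurableSet_Ioo)
  have hr : 0 < p.1 := (mem_prod.mp hp).1.1
  have hn : ‖circleMap 0 p.1 p.2‖ = p.1 := by
    rw [circleMap_zero, norm_mul, Complex.norm_real, Complex.norm_exp_ofReal_mul_I, mul_one,
      Real.norm_of_nonneg hr.le]
  simp only [hn, hH, hΨ]

end Definite

/-! ### The unfolded lift -/

section Unfolded

variable (c : (Fin 3 → ℤ) → ℂ) (t : ℝ) (ht : 0 < t)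

/-- The zero vector contributes nothing: `term(0) = 0`. [folklore] -/
theorem liftTermG_zero_vec (φ : ℍ → ℂ) (z w : ℍ) : liftTermG c t ht φ z 0 w = 0 := by
  have h0 : latSharp32 0 = 0 := by
    ext i; fin_cases i <;> simp [latSharp32]
  have hf : formEval (0 : V) (w : ℂ) = 0 := by simp [formEval]
  simp [liftTermG, h0, shintaniFn, hf]

/-- **The orbit integral of `ω`** (level `32`): `J(ω) = ∫_{F_{ω}} term(k_ω)`, `k_ω = ω.out`. [folklore] -/
def orbitIntegralG (φ : ℍ → ℂ) (z : ℍ) (ω : orbitRel.Quotient (Gamma0Plus 32) (Fin 3 → ℤ)) : ℂ :=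
  ∫ w in orbitDomain32 ω.out, liftTermG c t ht φ z ω.out w

/-- **Non-indefinite orbits contribute `0`** (`D` odd, `φ ∈ S₂(Γ₀(32))`). [cite: Shintani1975, §2,
proof of Prop. 2.3] -/
theorem orbitIntegralG_eq_zero_of_disc_nonpos {c : (Fin 3 → ℤ) → ℂ} (hinv : InvWeight32 c) (hb : BddWeight c)
    (t : ℝ) (ht : 0 < t) (f : CuspForm (Gamma0 32) 2) (z : ℍ)
    (ω : orbitRel.Quotient (Gamma0Plus 32) (Fin 3 → ℤ)) (hω : disc (latSharp32 ω.out) ≤ 0) :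
    orbitIntegralG c t ht f z ω = 0 := by
  unfold orbitIntegralG
  rcases lt_or_eq_of_le hω with hneg | hnull
  · exact integral_orbitDomainG_eq_zero_of_disc_neg hinv hb t ht f z hneg
  · by_cases hk : ω.out = 0
    · rw [hk]
      simp_rw [liftTermG_zero_vec]
      exact integral_zero _ _
    · exact integral_orbitDomainG_eq_zero_of_null hinv hb t ht f z hnull hk

/-- **The unfolded lift at level `32`**: for `D` odd and `φ ∈ S₂(Γ₀(32))`,
`Φ₃₂,D(z) = √(Im z) ∑_{ω ∈ ℤ³/Γ₀(32)⁺, disc ι♮₃₂(k_ω) > 0} J(ω)`. [cite: Shintani1975, §2, (2.14)] -/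
theorem liftG_eq_tsum_orbitIntegralG {c : (Fin 3 → ℤ) → ℂ} (hinv : InvWeight32 c) (hb : BddWeight c)
    (t : ℝ) (ht : 0 < t) (f : CuspForm (Gamma0 32) 2) (z : ℍ) :
    liftG c t ht f z = (Real.sqrt z.im : ℂ) *
      ∑' ω : orbitRel.Quotient (Gamma0Plus 32) (Fin 3 → ℤ),
        (if 0 < disc (latSharp32 ω.out) then orbitIntegralG c t ht f z ω else 0) := by
  rw [liftG_eq_tsum_integral t ht hb f z]
  congr 1
  have hsum : Summable fun k : Fin 3 → ℤ ↦ ∫ w in liftDomain32, liftTermG c t ht f z k w :=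
    (summable_norm_integral_liftTermG hb t ht f z).of_norm
  rw [tsum_eq_tsum_orbits_quotient (G := Gamma0Plus 32) hsum]
  refine tsum_congr fun ω ↦ ?_
  rw [(tsum_quotient_integral_liftTermG_eq hinv hb t ht f z ω.out).2]
  split_ifs with h
  · rfl
  · exact orbitIntegralG_eq_zero_of_disc_nonpos hinv hb t ht f z ω (not_lt.mp h)

end Unfolded

end Literature.NumberTheory.EllipticCurves.Shintani

noncomputable section

open scoped MatrixGroups ModularForm Modular Topology Pointwise
open Complex Real MeasureTheory Set Filter CongruenceSubgroup ModularGroup MulAction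
open UpperHalfPlane hiding I
open Literature.NumberTheory.EllipticCurves.ModularForms

namespace Literature.NumberTheory.EllipticCurves.Shintani

variable (c : (Fin 3 → ℤ) → ℂ) (t : ℝ) (ht : 0 < t)

/-- `q_w⁺(x) ≥ disc x`. [folklore] -/
theorem disc_le_majorant (w : ℍ) (x : V) : disc x ≤ majorant w x := by
  rw [majorant]; nlinarith [sq_nonneg (pw w x)]

/-- On an indefinite integral vector `disc ι♮₃₂(k) ≥ 1`. [folklore] -/
theorem one_le_disc_latSharp32 {k : Fin 3 → ℤ} (hk : 0 < disc (latSharp32 k)) : 1 ≤ disc (latSharp32 k) := by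
  rw [disc_latSharp32_eq_discK] at hk ⊢
  have : (0 : ℤ) < discK k := by exact_mod_cast hk
  exact_mod_cast (show (1 : ℤ) ≤ discK k by omega)

/-- **Monotonicity in `Im z`** of the terms on indefinite vectors:
`‖term_k(w; z)‖ ≤ e^{-2πt(Im z - Im z₀)} ‖term_k(w; z₀)‖` for `Im z ≥ Im z₀`, `disc ι♮₃₂(k) ≥ 1`. [folklore] -/
theorem norm_liftTermG_le_of_le_im (φ : ℍ → ℂ) {k : Fin 3 → ℤ} (hk : 1 ≤ disc (latSharp32 k))
    {z z₀ : ℍ} (hz : z₀.im ≤ z.im) (w : ℍ) :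
    ‖liftTermG c t ht φ z k w‖ ≤ Real.exp (-(2 * π * t * (z.im - z₀.im))) * ‖liftTermG c t ht φ z₀ k w‖ := by
  unfold liftTermG
  rw [norm_mul, norm_mul, norm_mul, norm_mul, norm_shintaniFn, norm_shintaniFn, im_mulPos, im_mulPos]
  have hmaj : 1 ≤ majorant w (latSharp32 k) := hk.trans (disc_le_majorant w _)
  have hexp : Real.exp (-(2 * π * (t * z.im) * majorant w (latSharp32 k))) ≤
      Real.exp (-(2 * π * t * (z.im - z₀.im))) * Real.exp (-(2 * π * (t * z₀.im) * majorant w (latSharp32 k))) := by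
    rw [← Real.exp_add]
    refine Real.exp_le_exp.mpr ?_
    have h1 : 0 ≤ t * (z.im - z₀.im) * (majorant w (latSharp32 k) - 1) :=
      mul_nonneg (mul_nonneg ht.le (sub_nonneg.mpr hz)) (sub_nonneg.mpr hmaj)
    nlinarith [Real.pi_pos]
  have h0 : 0 ≤ ‖φ w‖ * (‖c k‖ * ‖formEval (latSharp32 k) w‖) := by positivity
  calc ‖φ w‖ * (‖c k‖ * (‖formEval (latSharp32 k) w‖ * Real.exp (-(2 * π * (t * z.im) * majorant w (latSharp32 k)))))
      = ‖φ w‖ * (‖c k‖ * ‖formEval (latSharp32 k) w‖) *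
          Real.exp (-(2 * π * (t * z.im) * majorant w (latSharp32 k))) := by ring
    _ ≤ ‖φ w‖ * (‖c k‖ * ‖formEval (latSharp32 k) w‖) * (Real.exp (-(2 * π * t * (z.im - z₀.im))) *
          Real.exp (-(2 * π * (t * z₀.im) * majorant w (latSharp32 k)))) :=
        mul_le_mul_of_nonneg_left hexp h0
    _ = _ := by ring

/-- The map `q ↦ q.out • k₀` on `Γ/Γ_{k₀}` is injective. [folklore] -/
theorem quotient_out_smul_injective (k₀ : Fin 3 → ℤ) :
    Function.Injective fun q : Gamma0Plus 32 ⧸ stabK32 k₀ ↦ q.out • k₀ := by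
  intro q q' h
  have hmem : (q'.out)⁻¹ * q.out ∈ stabK32 k₀ := by
    rw [MulAction.mem_stabilizer_iff, mul_smul (q'.out)⁻¹ q.out k₀]
    have h' : q.out • k₀ = q'.out • k₀ := h
    rw [h', inv_smul_smul]
  have := QuotientGroup.eq.mpr hmem
  rw [QuotientGroup.out_eq', QuotientGroup.out_eq'] at this
  exact this.symm

variable {c} in
/-- **Exponential decay of the generic lift at `i∞`**, uniformly in `Re z`: for `Im z ≥ Im z₀`,
`‖Φ[c,t](z)‖ ≤ √(Im z) e^{-2πt(Im z - Im z₀)} ∑_k ∫_F ‖term_k(z₀)‖`. [cite: Shintani1975, §2, Prop. 2.4] -/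
theorem norm_liftG_le (hinv : InvWeight32 c) (hb : BddWeight c) (f : CuspForm (Gamma0 32) 2) (z₀ z : ℍ)
    (hz : z₀.im ≤ z.im) :
    ‖liftG c t ht f z‖ ≤ Real.sqrt z.im * Real.exp (-(2 * π * t * (z.im - z₀.im))) *
      ∑' k : Fin 3 → ℤ, ∫ w in liftDomain32, ‖liftTermG c t ht f z₀ k w‖ := by
  set E : ℝ := Real.exp (-(2 * π * t * (z.im - z₀.im))) with hE
  have hE0 : 0 < E := Real.exp_pos _
  set g : (Fin 3 → ℤ) → ℝ := fun k ↦ ∫ w in liftDomain32, ‖liftTermG c t ht f z k w‖ with hg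
  set g₀ : (Fin 3 → ℤ) → ℝ := fun k ↦ ∫ w in liftDomain32, ‖liftTermG c t ht f z₀ k w‖ with hg₀
  have hg_s : Summable g := summable_integral_norm_liftTermG hb t ht f z
  have hg₀_s : Summable g₀ := summable_integral_norm_liftTermG hb t ht f z₀
  have hg₀_nn : ∀ k, 0 ≤ g₀ k := fun k ↦ integral_nonneg fun _ ↦ norm_nonneg _
  -- the regrouped majorant `F₀(ω) = ∑_{x ∈ ω} g₀(x) = ∑_q g₀(q.out • ω.out)` and its sum
  set F₀ : orbitRel.Quotient (Gamma0Plus 32) (Fin 3 → ℤ) → ℝ := fun ω ↦ ∑' x : ω.orbit, g₀ x with hF₀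
  have hF₀_out : ∀ ω : orbitRel.Quotient (Gamma0Plus 32) (Fin 3 → ℤ),
      F₀ ω = ∑' q : Gamma0Plus 32 ⧸ stabK32 ω.out, g₀ (q.out • ω.out) := by
    intro ω
    rw [hF₀]
    dsimp only
    have hω := Quotient.out_eq' ω
    set x₁ := ω.out
    clear_value x₁
    subst hω
    rw [tsum_orbitRel_mk_eq, tsum_orbit_eq_tsum_quotient_stabilizer]
  have hF₀_hasSum : HasSum F₀ (∑' k, g₀ k) := by
    have h := hg₀_s.hasSum.tsum_fiberwise
      (Quotient.mk'' : (Fin 3 → ℤ) → orbitRel.Quotient (Gamma0Plus 32) (Fin 3 → ℤ))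
    refine h.congr_fun fun ω ↦ ?_
    rw [hF₀]
    exact (Equiv.setCongr (preimage_orbitRel_mk_eq_orbit ω)).symm.tsum_eq (fun x ↦ g₀ x)
  -- the orbit-wise bound
  set a : orbitRel.Quotient (Gamma0Plus 32) (Fin 3 → ℤ) → ℂ :=
    fun ω ↦ if 0 < disc (latSharp32 ω.out) then orbitIntegralG c t ht f z ω else 0 with ha
  have hbound : ∀ ω, ‖a ω‖ ≤ E * F₀ ω := by
    intro ω
    have hF₀nn : 0 ≤ F₀ ω := tsum_nonneg fun x ↦ hg₀_nn _
    rw [ha]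
    dsimp only
    split_ifs with hpos
    · have h1 := one_le_disc_latSharp32 hpos
      obtain ⟨-, hid⟩ := tsum_quotient_integral_liftTermG_eq hinv hb t ht f z ω.out
      rw [orbitIntegralG, ← hid]
      have hsq : Summable fun q : Gamma0Plus 32 ⧸ stabK32 ω.out ↦
          ‖∫ w in liftDomain32, liftTermG c t ht f z (q.out • ω.out) w‖ :=
        (summable_norm_integral_liftTermG hb t ht f z).comp_injective (quotient_out_smul_injective ω.out)
      have hsq₀ : Summable fun q : Gamma0Plus 32 ⧸ stabK32 ω.out ↦ g₀ (q.out • ω.out) :=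
        hg₀_s.comp_injective (quotient_out_smul_injective ω.out)
      refine (norm_tsum_le_tsum_norm hsq).trans ?_
      rw [hF₀_out, ← tsum_mul_left]
      refine Summable.tsum_le_tsum (fun q ↦ ?_) hsq (hsq₀.mul_left E)
      have hk1 : 1 ≤ disc (latSharp32 (q.out • ω.out)) := by rw [disc_latSharp32_smul]; exact h1
      calc ‖∫ w in liftDomain32, liftTermG c t ht f z (q.out • ω.out) w‖
          ≤ ∫ w in liftDomain32, ‖liftTermG c t ht f z (q.out • ω.out) w‖ := norm_integral_le_integral_norm _
        _ ≤ ∫ w in liftDomain32, E * ‖liftTermG c t ht f z₀ (q.out • ω.out) w‖ := by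
            refine integral_mono_of_nonneg (Eventually.of_forall fun _ ↦ norm_nonneg _)
              ((integrableOn_liftTermG hb t ht f z₀ _).norm.const_mul E) ?_
            exact Eventually.of_forall fun w ↦ norm_liftTermG_le_of_le_im c t ht f hk1 hz w
        _ = E * g₀ (q.out • ω.out) := by rw [integral_const_mul]
    · rw [norm_zero]; exact mul_nonneg hE0.le hF₀nn
  have ha_s : Summable fun ω ↦ ‖a ω‖ :=
    Summable.of_nonneg_of_le (fun _ ↦ norm_nonneg _) hbound (hF₀_hasSum.summable.mul_left E)
  rw [liftG_eq_tsum_orbitIntegralG hinv hb t ht f z, norm_mul, Complex.norm_real,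
    Real.norm_of_nonneg (Real.sqrt_nonneg _), mul_assoc]
  refine mul_le_mul_of_nonneg_left ?_ (Real.sqrt_nonneg _)
  calc ‖∑' ω, a ω‖ ≤ ∑' ω, ‖a ω‖ := norm_tsum_le_tsum_norm ha_s
    _ ≤ ∑' ω, E * F₀ ω := Summable.tsum_le_tsum hbound ha_s (hF₀_hasSum.summable.mul_left E)
    _ = E * ∑' k, g₀ k := by rw [tsum_mul_left, hF₀_hasSum.tsum_eq]

end Literature.NumberTheory.EllipticCurves.Shintani
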